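import Literature.Barriers.RiemannHypothesis.BohrDenseValuesAPoints
import Mathlib.MeasureTheory.Integral.Prod
import Mathlib.MeasureTheory.Integral.DominatedConvergence
import HarnessLib

/-!
# Tools for Voronin's universality theorem on discs, II: finite Euler products on the torus

Topic `Literature/NumberTheory/LFunctions`. Everything in this file is PROVED. It is the
`s`-dependent version (complex `s` ranging over a disc, instead of one fixed `σ`) of the torus
bookkeeping of the tree's proof of the Bohr–Courant theorem
(`Literature/Barriers/RiemannHypothesis/BohrDenseValuesProofs.lean`, §`BohrCourant`, and its
sibling `BohrDenseValuesAPoints.lean`, §`ShiftsOnDiscs`, both imported: their lemmas — flow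
phases, prime bookkeeping, boxes on the torus, orthogonality with complex coefficients, Fubini on
torus × interval — are used as they are, and only what is not there is proved here), as used in
Voronin's proof of universality (Steuding, *Value-Distribution of L-Functions*, §1.3,
(1.22)–(1.26); Bayart–Matheron, *Dynamics of Linear Operators*, §11.7):

* the Euler product along the Kronecker flow `t ↦ (−t log q/2π)_q` on the torus
  `(ℝ/ℤ)^{primes<P}` splits as `∏_{p<P} (1 − p^{−s−it})⁻¹ = Z_{<N}(s, flow t) · Q_{[N,P)}(s, flow t)`
  (`eulerProduct_eq_steering_mul_tail`);
* the tail product is close to `1` when its first-order part `L(s,θ) = Σ_{N≤q<P} q^{−s} e(θ_q)` and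
  `Σ q^{−2 Re s}` are small (`norm_tailProduct_sub_one_le`);
* the circle mean square of the tail sum `L` has torus average `≤ 2π (Σ q^{-2σ₁}) ∫ φ`
  (`integral_mul_circleMeanSquare_le`, Fubini on torus × circle).

## References

* [Steuding2007] J. Steuding, *Value-Distribution of L-Functions*, LNM 1877, §1.3 (1.22)–(1.26).
* [BayartMatheron2009] F. Bayart, É. Matheron, *Dynamics of Linear Operators*, §11.7.
* [Titchmarsh1986] E. C. Titchmarsh, *The Theory of the Riemann Zeta-Function*, §11.9.
-/

noncomputable section

open Complex Filter Set Metric MeasureTheory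
open scoped Real

namespace Literature.NumberTheory.LFunctions

namespace VoroninTorus

open Literature.NumberTheory.DiophantineApproximation Literature.Barriers.RiemannHypothesis.BohrCourant
open Literature.Barriers.RiemannHypothesis.ShiftsOnDiscs

/-! ### Prime powers with complex exponents -/

/-- The norm of `n^{-s}` is `n^{-Re s}` (`n ≥ 1`). [folklore] -/
theorem norm_natCast_cpow_neg {n : ℕ} (hn : n ≠ 0) (s : ℂ) :
    ‖(n : ℂ) ^ (-s)‖ = (n : ℝ) ^ (-s.re) := by
  rw [Complex.norm_natCast_cpow_of_pos (Nat.pos_of_ne_zero hn), neg_re]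

/-! ### The local data `q^{-s} e(x)` -/

/-- The norm of the local datum `q^{-s} e(x)` is `q^{-Re s}` (`q ≥ 1`). [folklore] -/
theorem norm_cpow_mul_fourier {q : ℕ} (hq : q ≠ 0) (s : ℂ) (x : UnitAddCircle) :
    ‖(q : ℂ) ^ (-s) * fourier 1 x‖ = (q : ℝ) ^ (-s.re) := by
  rw [norm_mul, norm_fourier_one, mul_one, norm_natCast_cpow_neg hq]

/-- The local factor `1 - q^{-s} e(x)` does not vanish for `q ≥ 2` and `Re s > 0`: this is
`ShiftsOnDiscs.one_sub_fourier_mul_cpow_ne_zero` with the two factors in the order used by the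
steering products of this file and of the assembly. [folklore] -/
theorem one_sub_cpow_mul_fourier_ne_zero {q : ℕ} (hq : 2 ≤ q) {s : ℂ} (hs : 0 < s.re)
    (x : UnitAddCircle) : (1 : ℂ) - (q : ℂ) ^ (-s) * fourier 1 x ≠ 0 := by
  rw [mul_comm]; exact one_sub_fourier_mul_cpow_ne_zero hq x hs

/-! ### The Euler product along the flow, and the tail product -/

section Torus

variable {P N : ℕ}

/-- **The Euler product along the flow** `t ↦ (t · (-log q/2π))_q`: for `N ≤ P` and complex `s`,
`∏_{p<P} (1 - p^{-(s+it)})⁻¹ = Z_{<N}(s, flow t) · Q_{[N,P)}(s, flow t)`, where `Z_{<N}` is the twisted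
product over the primes below `N` and `Q` the one over the primes in `[N, P)`. [folklore] -/
theorem eulerProduct_eq_steering_mul_tail (hNP : N ≤ P) (s : ℂ)
    (ext : UnitAddTorus ↥(P.primesBelow) → ℕ → UnitAddCircle)
    (hext : ext = fun θ n ↦ if h : n ∈ P.primesBelow then θ ⟨n, h⟩ else 0) (t : ℝ) :
    ∏ p ∈ P.primesBelow, (1 - (p : ℂ) ^ (-(s + t * I)))⁻¹ =
      (∏ n ∈ N.primesBelow, (1 - (n : ℂ) ^ (-s) * fourier 1
        (ext (fun q : ↥(P.primesBelow) ↦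
          (((t * (-Real.log q.1 / (2 * Real.pi))) : ℝ) : UnitAddCircle)) n))⁻¹) *
      ∏ q ∈ (Finset.univ : Finset ↥(P.primesBelow)).filter (fun q ↦ N ≤ q.1),
        (1 - (q.1 : ℂ) ^ (-s) *
          fourier 1 ((((t * (-Real.log q.1 / (2 * Real.pi))) : ℝ) : UnitAddCircle)))⁻¹ := by
  classical
  conv_lhs => rw [primesBelow_eq_union hNP, Finset.prod_union (disjoint_primesBelow_filter N P)]
  congr 1
  · refine Finset.prod_congr rfl fun n hn ↦ ?_
    have hnP : n ∈ P.primesBelow := mem_primesBelow_of_le hNP hn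
    have hn0 : n ≠ 0 := (Nat.prime_of_mem_primesBelow hn).ne_zero
    rw [hext]
    simp only [dif_pos hnP]
    rw [fourier_one_flow_eq_cpow hn0, natCast_cpow_neg_add_mul_I hn0]
  · rw [prod_univ_filter_coe (P.primesBelow) (fun n ↦ N ≤ n) (fun n ↦ (1 - (n : ℂ) ^ (-s) *
      fourier 1 ((((t * (-Real.log n / (2 * Real.pi))) : ℝ) : UnitAddCircle)))⁻¹)]
    refine Finset.prod_congr rfl fun n hn ↦ ?_
    have hn0 : n ≠ 0 := (Nat.prime_of_mem_primesBelow (Finset.mem_filter.1 hn).1).ne_zero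
    rw [fourier_one_flow_eq_cpow hn0, natCast_cpow_neg_add_mul_I hn0]

/-- The tail product is close to `1`: for `N ≥ 4`, `Re s > 1/2`,
`|∏_{q∈S} (1 - q^{-s} e(θ_q))⁻¹ - 1| ≤ 2 (|Σ_{q∈S} q^{-s} e(θ_q)| + Σ_{q∈S} q^{-2 Re s})` as soon as
the right-hand bracket is `≤ 1` (`S` = the coordinates `q ≥ N`). [folklore] -/
theorem norm_tailProduct_sub_one_le (hN : 4 ≤ N) {s : ℂ} (hs : 1 / 2 < s.re)
    (θ : UnitAddTorus ↥(P.primesBelow))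
    (hsmall : ‖∑ q ∈ (Finset.univ : Finset ↥(P.primesBelow)).filter (fun q ↦ N ≤ q.1),
        (q.1 : ℂ) ^ (-s) * fourier 1 (θ q)‖ +
      ∑ q ∈ (Finset.univ : Finset ↥(P.primesBelow)).filter (fun q ↦ N ≤ q.1),
        ((q.1 : ℝ) ^ (-s.re)) ^ 2 ≤ 1) :
    ‖∏ q ∈ (Finset.univ : Finset ↥(P.primesBelow)).filter (fun q ↦ N ≤ q.1),
        (1 - (q.1 : ℂ) ^ (-s) * fourier 1 (θ q))⁻¹ - 1‖ ≤
      2 * (‖∑ q ∈ (Finset.univ : Finset ↥(P.primesBelow)).filter (fun q ↦ N ≤ q.1),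
        (q.1 : ℂ) ^ (-s) * fourier 1 (θ q)‖ +
      ∑ q ∈ (Finset.univ : Finset ↥(P.primesBelow)).filter (fun q ↦ N ≤ q.1),
        ((q.1 : ℝ) ^ (-s.re)) ^ 2) := by
  have hq0 : ∀ q ∈ (Finset.univ : Finset ↥(P.primesBelow)).filter (fun q ↦ N ≤ q.1),
      q.1 ≠ 0 := fun q _ ↦ (Nat.prime_of_mem_primesBelow q.2).ne_zero
  have hnorm : ∀ q ∈ (Finset.univ : Finset ↥(P.primesBelow)).filter (fun q ↦ N ≤ q.1),
      ‖(q.1 : ℂ) ^ (-s) * fourier 1 (θ q)‖ = (q.1 : ℝ) ^ (-s.re) := fun q hq ↦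
    norm_cpow_mul_fourier (hq0 q hq) _ _
  have hz : ∀ q ∈ (Finset.univ : Finset ↥(P.primesBelow)).filter (fun q ↦ N ≤ q.1),
      ‖(q.1 : ℂ) ^ (-s) * fourier 1 (θ q)‖ ≤ 1 / 2 := by
    intro q hq
    rw [hnorm q hq]
    exact rpow_neg_le_half (hN.trans (Finset.mem_filter.1 hq).2) hs
  have hsq : ∑ q ∈ (Finset.univ : Finset ↥(P.primesBelow)).filter (fun q ↦ N ≤ q.1),
      ‖(q.1 : ℂ) ^ (-s) * fourier 1 (θ q)‖ ^ 2 =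
      ∑ q ∈ (Finset.univ : Finset ↥(P.primesBelow)).filter (fun q ↦ N ≤ q.1),
        ((q.1 : ℝ) ^ (-s.re)) ^ 2 := Finset.sum_congr rfl fun q hq ↦ by rw [hnorm q hq]
  have h := FiniteEulerPhases.norm_prod_inv_one_sub_sub_one_le _ hz (by rwa [hsq])
  rwa [hsq] at h

/-- The sum of squares of the tail data is bounded by the integer tail `Σ_{k≥0} (k+N)^{-2σ}` as
soon as `Re s ≥ σ > 1/2`. [folklore] -/
theorem sum_sq_rpow_le_tail {σ : ℝ} (hσ : 1 / 2 < σ) {s : ℂ} (hs : σ ≤ s.re) :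
    ∑ q ∈ (Finset.univ : Finset ↥(P.primesBelow)).filter (fun q ↦ N ≤ q.1),
        ((q.1 : ℝ) ^ (-s.re)) ^ 2 ≤ ∑' k : ℕ, ((k + N : ℕ) : ℝ) ^ (-(2 * σ)) := by
  have e : ∀ n : ℕ, ((n : ℝ) ^ (-s.re)) ^ 2 = (n : ℝ) ^ (-(2 * s.re)) := by
    intro n
    rw [← Real.rpow_natCast, ← Real.rpow_mul (Nat.cast_nonneg n)]
    congr 1; push_cast; ring
  have hle : ∀ n : ℕ, n ∈ (P.primesBelow).filter (fun n ↦ N ≤ n) →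
      (n : ℝ) ^ (-(2 * s.re)) ≤ (n : ℝ) ^ (-(2 * σ)) := by
    intro n hn
    have hn1 : (1 : ℝ) ≤ n := by
      exact_mod_cast (Nat.prime_of_mem_primesBelow (Finset.mem_filter.1 hn).1).one_lt.le
    exact Real.rpow_le_rpow_of_exponent_le hn1 (by linarith)
  rw [sum_univ_filter_coe (P.primesBelow) (fun n ↦ N ≤ n) (fun n ↦ ((n : ℝ) ^ (-s.re)) ^ 2)]
  simp_rw [e]
  calc ∑ n ∈ (P.primesBelow).filter (fun n ↦ N ≤ n), (n : ℝ) ^ (-(2 * s.re))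
      ≤ ∑ n ∈ (P.primesBelow).filter (fun n ↦ N ≤ n), (n : ℝ) ^ (-(2 * σ)) :=
        Finset.sum_le_sum hle
    _ ≤ ∑ n ∈ Finset.Ico N P, (n : ℝ) ^ (-(2 * σ)) :=
        sum_primesBelow_filter_le_sum_Ico _ fun n ↦ by positivity
    _ ≤ ∑' k : ℕ, ((k + N : ℕ) : ℝ) ^ (-(2 * σ)) := EulerProductMeanSquare.sum_Ico_rpow_le_tsum hσ N P

end Torus

/-! ### First-order sums as functions of `(s, θ)`, and circle mean squares on the torus -/

section FirstOrder

variable {P : ℕ}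

/-- The first-order sum `L(s, θ) = Σ_{q∈S} q^{-s} e(θ_q)` is jointly continuous in `(s, θ)`.
[folklore] -/
theorem continuous_firstOrderSum (S : Finset ↥(P.primesBelow)) :
    Continuous fun p : ℂ × UnitAddTorus ↥(P.primesBelow) ↦
      ∑ q ∈ S, (q.1 : ℂ) ^ (-p.1) * fourier 1 (p.2 q) := by
  refine continuous_finsetSum _ fun q _ ↦ ?_
  have hq : (q.1 : ℂ) ≠ 0 := by exact_mod_cast (Nat.prime_of_mem_primesBelow q.2).ne_zero
  exact (Continuous.const_cpow (continuous_fst.neg) (Or.inl hq)).mul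
    ((fourier 1).continuous.comp ((continuous_apply q).comp continuous_snd))

/-- A crude uniform bound: `|L(s, θ)| ≤ #S` for `Re s ≥ 0`. [folklore] -/
theorem norm_firstOrderSum_le (S : Finset ↥(P.primesBelow)) {s : ℂ} (hs : 0 ≤ s.re)
    (θ : UnitAddTorus ↥(P.primesBelow)) :
    ‖∑ q ∈ S, (q.1 : ℂ) ^ (-s) * fourier 1 (θ q)‖ ≤ S.card := by
  have h : ∀ q ∈ S, ‖(q.1 : ℂ) ^ (-s) * fourier 1 (θ q)‖ ≤ 1 := by
    intro q _
    have hq1 : (1 : ℝ) ≤ q.1 := by exact_mod_cast (Nat.prime_of_mem_primesBelow q.2).one_lt.le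
    rw [norm_cpow_mul_fourier (Nat.prime_of_mem_primesBelow q.2).ne_zero]
    exact Real.rpow_le_one_of_one_le_of_nonpos hq1 (by linarith)
  calc ‖∑ q ∈ S, (q.1 : ℂ) ^ (-s) * fourier 1 (θ q)‖ ≤ ∑ q ∈ S, ‖(q.1 : ℂ) ^ (-s) * fourier 1 (θ q)‖ :=
        norm_sum_le _ _
    _ ≤ ∑ q ∈ S, (1 : ℝ) := Finset.sum_le_sum h
    _ = S.card := by simp

/-- **Interchanging the torus integral with an interval integral** for a jointly continuous
integrand: `ShiftsOnDiscs.integral_torus_interval_swap` with its uniform bound supplied by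
compactness of `[a, b] × (ℝ/ℤ)^ι` (the integrand restricted to `[a, b]`; stated for `a ≤ b`).
[folklore] -/
theorem integral_intervalIntegral_swap {ι : Type*} [Fintype ι] {F : ℝ → UnitAddTorus ι → ℝ}
    (hF : Continuous (Function.uncurry F)) {a b : ℝ} (hab : a ≤ b) :
    ∫ θ : UnitAddTorus ι, ∫ α in a..b, F α θ = ∫ α in a..b, ∫ θ : UnitAddTorus ι, F α θ := by
  -- clamp the interval variable to `[a, b]` to get a bounded continuous integrand
  set G : UnitAddTorus ι → ℝ → ℝ := fun θ u ↦ F (max a (min u b)) θ with hG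
  have hclamp : Continuous fun u : ℝ ↦ max a (min u b) := continuous_const.max (continuous_id.min continuous_const)
  have hGc : Continuous (Function.uncurry G) :=
    hF.comp ((hclamp.comp continuous_snd).prodMk continuous_fst)
  have hK : IsCompact (Icc a b ×ˢ (univ : Set (UnitAddTorus ι))) := isCompact_Icc.prod isCompact_univ
  obtain ⟨C, hC⟩ := hK.exists_bound_of_continuousOn hF.continuousOn
  have hGb : ∀ θ u, ‖G θ u‖ ≤ C := fun θ u ↦
    hC (max a (min u b), θ) ⟨⟨le_max_left _ _, max_le hab (min_le_right _ _)⟩, mem_univ _⟩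
  have hGF : ∀ θ, ∀ u ∈ Set.uIcc a b, G θ u = F u θ := by
    intro θ u hu
    rw [Set.uIcc_of_le hab] at hu
    simp only [hG, min_eq_left hu.2, max_eq_right hu.1]
  have h := integral_torus_interval_swap hGc hGb hab
  rw [intervalIntegral.integral_congr (fun u hu ↦ integral_congr_ae (ae_of_all _ fun θ ↦ hGF θ u hu))] at h
  rw [← h]
  exact integral_congr_ae (ae_of_all _ fun θ ↦ intervalIntegral.integral_congr fun u hu ↦
    (hGF θ u hu).symm)

/-- The circle mean square of the first-order sum, `θ ↦ ∫₀^{2π} |L(c + ρ'e^{iα}, θ)|² dα`, is a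
continuous function on the torus. [folklore] -/
theorem continuous_circleMeanSquare_firstOrderSum (S : Finset ↥(P.primesBelow)) (c : ℂ) (ρ' : ℝ) :
    Continuous fun θ : UnitAddTorus ↥(P.primesBelow) ↦
      ∫ α in (0 : ℝ)..2 * π, ‖∑ q ∈ S, (q.1 : ℂ) ^ (-circleMap c ρ' α) * fourier 1 (θ q)‖ ^ 2 := by
  refine intervalIntegral.continuous_parametric_intervalIntegral_of_continuous' ?_ _ _
  have h := (continuous_firstOrderSum S).comp
    (((continuous_circleMap c ρ').comp continuous_snd).prodMk continuous_fst :
      Continuous fun p : UnitAddTorus ↥(P.primesBelow) × ℝ ↦ (circleMap c ρ' p.2, p.1))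
  exact (continuous_norm.comp h).pow 2

/-- **Torus average of the weighted circle mean square of the first-order sum.** If `φ ≥ 0` is a
continuous weight not depending on the coordinates in `S` and `Re(c + ρ'e^{iα}) ≥ σ₁` on the
circle, then `∫ φ(θ) ∫₀^{2π} |L(c+ρ'e^{iα}, θ)|² dα dθ ≤ 2π (Σ_{q∈S} q^{-2σ₁}) ∫ φ` (Fubini and the
orthogonality relation `ShiftsOnDiscs.integral_mul_norm_sq_sum_fourier_complex` on each circle
point). [folklore] -/
theorem integral_mul_circleMeanSquare_le (S : Finset ↥(P.primesBelow))
    {φ : UnitAddTorus ↥(P.primesBelow) → ℝ} (hφc : Continuous φ)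
    (hφ : ∀ j ∈ S, ∀ (x : UnitAddTorus ↥(P.primesBelow)) (a : UnitAddCircle),
      φ (x + Pi.single j a) = φ x)
    (hφ0 : ∀ θ, 0 ≤ φ θ) (c : ℂ) (ρ' : ℝ) {σ₁ : ℝ} (hσ₁ : ∀ α, σ₁ ≤ (circleMap c ρ' α).re) :
    ∫ θ : UnitAddTorus ↥(P.primesBelow), φ θ *
        ∫ α in (0 : ℝ)..2 * π, ‖∑ q ∈ S, (q.1 : ℂ) ^ (-circleMap c ρ' α) * fourier 1 (θ q)‖ ^ 2 ≤
      2 * π * (∑ q ∈ S, ((q.1 : ℝ) ^ (-σ₁)) ^ 2) * ∫ θ : UnitAddTorus ↥(P.primesBelow), φ θ := by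
  -- pull the weight inside and swap the integrals
  have e1 : ∀ θ : UnitAddTorus ↥(P.primesBelow), φ θ *
      ∫ α in (0 : ℝ)..2 * π, ‖∑ q ∈ S, (q.1 : ℂ) ^ (-circleMap c ρ' α) * fourier 1 (θ q)‖ ^ 2 =
      ∫ α in (0 : ℝ)..2 * π, φ θ * ‖∑ q ∈ S, (q.1 : ℂ) ^ (-circleMap c ρ' α) * fourier 1 (θ q)‖ ^ 2 :=
    fun θ ↦ (intervalIntegral.integral_const_mul _ _).symm
  simp_rw [e1]
  have hFc : Continuous (Function.uncurry fun (α : ℝ) (θ : UnitAddTorus ↥(P.primesBelow)) ↦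
      φ θ * ‖∑ q ∈ S, (q.1 : ℂ) ^ (-circleMap c ρ' α) * fourier 1 (θ q)‖ ^ 2) := by
    have h := (continuous_firstOrderSum S).comp
      (((continuous_circleMap c ρ').comp continuous_fst).prodMk continuous_snd :
        Continuous fun p : ℝ × UnitAddTorus ↥(P.primesBelow) ↦ (circleMap c ρ' p.1, p.2))
    exact (hφc.comp continuous_snd).mul ((continuous_norm.comp h).pow 2)
  rw [integral_intervalIntegral_swap hFc (by positivity)]
  -- orthogonality on each circle point
  have e2 : ∀ α : ℝ, ∫ θ : UnitAddTorus ↥(P.primesBelow),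
      φ θ * ‖∑ q ∈ S, (q.1 : ℂ) ^ (-circleMap c ρ' α) * fourier 1 (θ q)‖ ^ 2 =
      (∑ q ∈ S, ‖(q.1 : ℂ) ^ (-circleMap c ρ' α)‖ ^ 2) * ∫ θ : UnitAddTorus ↥(P.primesBelow), φ θ :=
    fun α ↦ integral_mul_norm_sq_sum_fourier_complex S _ hφc hφ
  simp_rw [e2]
  -- monotonicity in `α`
  have hI0 : 0 ≤ ∫ θ : UnitAddTorus ↥(P.primesBelow), φ θ := integral_nonneg hφ0
  have hle : ∀ α ∈ Icc (0 : ℝ) (2 * π),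
      (∑ q ∈ S, ‖(q.1 : ℂ) ^ (-circleMap c ρ' α)‖ ^ 2) * ∫ θ : UnitAddTorus ↥(P.primesBelow), φ θ ≤
      (∑ q ∈ S, ((q.1 : ℝ) ^ (-σ₁)) ^ 2) * ∫ θ : UnitAddTorus ↥(P.primesBelow), φ θ := by
    intro α _
    refine mul_le_mul_of_nonneg_right (Finset.sum_le_sum fun q _ ↦ ?_) hI0
    have hq0 : q.1 ≠ 0 := (Nat.prime_of_mem_primesBelow q.2).ne_zero
    have hq1 : (1 : ℝ) ≤ q.1 := by exact_mod_cast (Nat.prime_of_mem_primesBelow q.2).one_lt.le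
    rw [norm_natCast_cpow_neg hq0]
    exact pow_le_pow_left₀ (by positivity)
      (Real.rpow_le_rpow_of_exponent_le hq1 (neg_le_neg (hσ₁ α))) 2
  have hcont : Continuous fun α : ℝ ↦
      (∑ q ∈ S, ‖(q.1 : ℂ) ^ (-circleMap c ρ' α)‖ ^ 2) * ∫ θ : UnitAddTorus ↥(P.primesBelow), φ θ := by
    refine Continuous.mul (continuous_finsetSum _ fun q _ ↦ ?_) continuous_const
    have hq : (q.1 : ℂ) ≠ 0 := by exact_mod_cast (Nat.prime_of_mem_primesBelow q.2).ne_zero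
    exact (continuous_norm.comp
      (Continuous.const_cpow (continuous_circleMap c ρ').neg (Or.inl hq))).pow 2
  calc ∫ α in (0 : ℝ)..2 * π,
        (∑ q ∈ S, ‖(q.1 : ℂ) ^ (-circleMap c ρ' α)‖ ^ 2) * ∫ θ : UnitAddTorus ↥(P.primesBelow), φ θ
      ≤ ∫ α in (0 : ℝ)..2 * π,
        (∑ q ∈ S, ((q.1 : ℝ) ^ (-σ₁)) ^ 2) * ∫ θ : UnitAddTorus ↥(P.primesBelow), φ θ :=
        intervalIntegral.integral_mono_on (by positivity) (hcont.intervalIntegrable _ _)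
          intervalIntegrable_const hle
    _ = 2 * π * (∑ q ∈ S, ((q.1 : ℝ) ^ (-σ₁)) ^ 2) * ∫ θ : UnitAddTorus ↥(P.primesBelow), φ θ := by
        rw [intervalIntegral.integral_const, smul_eq_mul]; ring

end FirstOrder

end VoroninTorus

end Literature.NumberTheory.LFunctions
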